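import Literature.IUT.LogVolume.GenuineTowerLocalType
import HarnessLib

/-!
# The `l`-division layer of a genuine Θ-volume datum is ramified of index EXACTLY `l` at every bad place away from `2·l`
# ([IUTchI] Ex. 3.2 (iv): `K_w ⊇ F_v(q_v^{1/l})`; [IUTchIV] Prop. 1.8 (vii): `e ∣ l`; proof-only)

Mochizuki, *Inter-universal Teichmüller theory I* (RIMS manuscript), Ex. 3.2 (iv) p. 71 (at a bad place `v ∈ 𝕍^bad`
the covering `K = F(E_F[l])` contains `F_v(q_v^{1/l})`, `l ∤ ord_v(q_v)`, so `l ∣ e(w | v)`); *IUT IV*, Prop. 1.8 (vii)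
p. 19 and Thm. 1.10 Step (ii) p. 24 (`e(w | v) ∣ l` at a multiplicative place `v ∤ l`); J.-P. Serre, Invent. Math.
**15** (1972), §1.11–§1.12.

For a genuine Θ-volume datum `T : Cor22.ThetaVolumeDatumAt P l` (abc-iut-S2's `GenuineLogThetaPoint.lean`) and a place
`u` of `K = T.K` of residue characteristic `p ∉ {2, l}` over a BAD place of `λ` (so that `w = u ∩ F` is a place of
multiplicative reduction of `E_F`, in `𝕍(F)^bad` by the (P5) choice `T.isP5Choice`), the two divisibilities already in
the tree — `l ∣ e(u | w)` (abc-iut's `InitialThetaData…l_dvd_ramificationIdx_of_under_mem_VFbad`, from `l ∤ ord_w q`) and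
`e(u | w) ∣ l` (abc-iut-S-d1's `ThetaVolumeDatumAt.ramificationIdx_dvd_prime`) — combine to the EXACT index:

* `ThetaVolumeDatumAt.finitePlace_mem_VFbad_of_badPlaces` — `w ∈ 𝕍(F)^bad` for a place `w ∤ 2l` of `F` over a bad place
  of `λ`;
* **`ThetaVolumeDatumAt.ramificationIdx_F_K_eq_prime`** — `e(u | w) = l`;
* **`ThetaVolumeDatumAt.ramificationIdx_int_eq_mul_prime`** — `e(u | p) = e(w | p) · l` (absolute form, Neukirch II
  (6.8)): the `K/F` layer contributes EXACTLY the factor `l` to the local type at every bad prime `p ∉ {2, l}` — INCLUDING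
  the wild primes `p ∈ {3, 5}` of the abc-iut R-W window table (GAP G-Wnum2-1, Stage 1: `e(K_u/ℚ_p) = l · e(F_w/ℚ_p)`).

Proof-only (no definition, no named fact); inputs BY NAME; classical; TAKES NO SIDE on [IUTchIII] Cor. 3.12.
[cite: Mochizuki2012, IUTchI Ex. 3.2 (iv) p. 71] [cite: Mochizuki2012, IUTchIV Prop. 1.8 (vii) p. 19]
[claim: Mochizuki2012, status: disputed] for every IUT quotation.
-/

noncomputable section

open scoped Classical

namespace Literature.IUT.LogVolume

namespace Cor22

namespace ThetaVolumeDatumAt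

open NumberField IsDedekindDomain Literature.NumberTheory.DiophantineGeometry.GenEll
open Literature.NumberTheory.EllipticCurves Literature.NumberTheory.NumberFields Literature.IUT.HodgeTheaters
open WeierstrassCurve Field

variable {P : NFPoint} {l : ℕ} (T : ThetaVolumeDatumAt P l)

/-- **A place `w ∤ 2l` of `F` over a bad place of `λ` lies in `𝕍(F)^bad`**: `E_F` is semistable with `j(E_F) = j(λ)`,
hence multiplicative at `w` (abc-iut's `hasMultiplicativeReductionAt_of_isSemistable_of_j_eq`), and `𝕍^bad_mod` is the (P5)
choice (`T.isP5Choice`: the multiplicative places not over `2l`). [cite: Mochizuki2012, IUTchIV Cor. 2.2 (ii) proof (P5) p. 46]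
[claim: Mochizuki2012, status: disputed] -/
theorem finitePlace_mem_VFbad_of_badPlaces
    (w : letI := T.instFieldF; letI := T.instNumberFieldF; HeightOneSpectrum (𝓞 T.F))
    (hw : letI := T.instFieldF; letI := T.instNumberFieldF; residueChar T.F w ∉ ({2, l} : Finset ℕ))
    (hbad : letI := T.instFieldF; letI := T.instNumberFieldF; letI := T.instAlgebraF
      finBelow P.F T.F w ∈ badPlaces P) :
    (letI := T.instFieldF; letI := T.instNumberFieldF; letI := T.instAlgebraF; letI := T.instFieldK
     letI := T.instNumberFieldK; letI := T.instAlgebraK; letI := T.instFieldFbar; letI := T.instAlgebraFbar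
     letI := T.instAlgebraKFbar; letI := T.instIsElliptic
     FinitePlace.mk w ∈ T.D.VFbad) := by
  letI := T.instFieldF; letI := T.instNumberFieldF; letI := T.instAlgebraF; letI := T.instFieldK
  letI := T.instNumberFieldK; letI := T.instAlgebraK; letI := T.instFieldFbar; letI := T.instAlgebraFbar
  letI := T.instAlgebraKFbar; letI := T.instIsElliptic
  have hmult : T.E.HasMultiplicativeReductionAt w :=
    hasMultiplicativeReductionAt_of_isSemistable_of_j_eq T.F T.D.isSemistable T.j_eq w hbad
  rw [T.isP5Choice (FinitePlace.mk w), FinitePlace.maximalIdeal_mk]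
  refine ⟨fun q hq hqw => ?_, hmult⟩
  have hq2l : q = 2 ∨ q = l := by simpa only [Finset.mem_insert, Finset.mem_singleton] using hq
  have hqprime : q.Prime := by
    rcases hq2l with rfl | rfl
    · exact Nat.prime_two
    · exact T.D.l_prime
  have hchar : residueChar T.F w = q := (natCast_mem_asIdeal_iff_residueChar_eq w hqprime).1 hqw
  apply hw
  rw [hchar]
  simpa only [Finset.mem_insert, Finset.mem_singleton] using hq2l

/-- **`e(u | w) = l` EXACTLY** for every place `u` of the `l`-division field `K` of a genuine Θ-volume datum, of residue
characteristic `p ∉ {2, l}`, over a BAD place of `λ` (`w = u ∩ F`): `l ∣ e(u|w)` ([IUTchI] Ex. 3.2 (iv), the tree's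
`l_dvd_ramificationIdx_of_under_mem_VFbad`) and `e(u|w) ∣ l` ([IUTchIV] Prop. 1.8 (vii), abc-iut-S-d1's
`ramificationIdx_dvd_prime`). [cite: Mochizuki2012, IUTchI Ex. 3.2 (iv) p. 71] [cite: Mochizuki2012, IUTchIV Prop. 1.8 (vii) p. 19]
[claim: Mochizuki2012, status: disputed] -/
theorem ramificationIdx_F_K_eq_prime
    (u : letI := T.instFieldK; letI := T.instNumberFieldK; HeightOneSpectrum (𝓞 T.K))
    (hu : letI := T.instFieldK; letI := T.instNumberFieldK; residueChar T.K u ∉ ({2, l} : Finset ℕ))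
    (hbad : letI := T.instFieldF; letI := T.instNumberFieldF; letI := T.instAlgebraF; letI := T.instFieldK
      letI := T.instNumberFieldK; letI := T.instAlgebraK
      finBelow P.F T.F (finBelow T.F T.K u) ∈ badPlaces P) :
    (letI := T.instFieldF; letI := T.instNumberFieldF; letI := T.instFieldK; letI := T.instNumberFieldK
     letI := T.instAlgebraK
     u.asIdeal.ramificationIdx (𝓞 T.F)) = l := by
  letI := T.instFieldF; letI := T.instNumberFieldF; letI := T.instAlgebraF; letI := T.instFieldK
  letI := T.instNumberFieldK; letI := T.instAlgebraK; letI := T.instFieldFbar; letI := T.instAlgebraFbar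
  letI := T.instAlgebraKFbar; letI := T.instIsElliptic
  simp only [Finset.mem_insert, Finset.mem_singleton, not_or] at hu
  obtain ⟨hu2, hul⟩ := hu
  set w := finBelow T.F T.K u with hwdef
  have hw : residueChar T.F w ∉ ({2, l} : Finset ℕ) := by
    rw [hwdef, residueChar_finBelow]
    simp only [Finset.mem_insert, Finset.mem_singleton, not_or]
    exact ⟨hu2, hul⟩
  have hVF : FinitePlace.mk (u.under (𝓞 T.F)) ∈ T.D.VFbad := T.finitePlace_mem_VFbad_of_badPlaces w hw hbad
  have hdvd : u.asIdeal.ramificationIdx (𝓞 T.F) ∣ l := T.ramificationIdx_dvd_prime u hul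
  have hl : l ∣ u.asIdeal.ramificationIdx (𝓞 T.F) := by
    haveI : w.asIdeal.IsMaximal := w.isMaximal
    have h := ThetaData.l_dvd_ramificationIdx_of_under_mem_VFbad T.D hVF
    rwa [show u.under (𝓞 T.F) = w from rfl,
      Ideal.ramificationIdx'_eq_ramificationIdx w.asIdeal u.asIdeal w.ne_bot] at h
  exact Nat.dvd_antisymm hdvd hl

/-- **`e(u | p) = e(w | p) · l`** (absolute form in the tower `ℤ ⊆ 𝓞_F ⊆ 𝓞_K`, Neukirch II (6.8)): at a bad prime
`p ∉ {2, l}` the `l`-division layer contributes EXACTLY the factor `l` to the local type of `K_u/ℚ_p` — also at the wild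
primes `p ∈ {3, 5}`. [cite: Mochizuki2012, IUTchI Ex. 3.2 (iv) p. 71] [cite: NeukirchANT1999, Ch. II Prop. (6.8)]
[claim: Mochizuki2012, status: disputed] -/
theorem ramificationIdx_int_eq_mul_prime
    (u : letI := T.instFieldK; letI := T.instNumberFieldK; HeightOneSpectrum (𝓞 T.K))
    (hu : letI := T.instFieldK; letI := T.instNumberFieldK; residueChar T.K u ∉ ({2, l} : Finset ℕ))
    (hbad : letI := T.instFieldF; letI := T.instNumberFieldF; letI := T.instAlgebraF; letI := T.instFieldK
      letI := T.instNumberFieldK; letI := T.instAlgebraK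
      finBelow P.F T.F (finBelow T.F T.K u) ∈ badPlaces P) :
    (letI := T.instFieldK; letI := T.instNumberFieldK
     u.asIdeal.ramificationIdx ℤ) =
      (letI := T.instFieldF; letI := T.instNumberFieldF; letI := T.instFieldK; letI := T.instNumberFieldK
       letI := T.instAlgebraK
       (finBelow T.F T.K u).asIdeal.ramificationIdx ℤ) * l := by
  letI := T.instFieldF; letI := T.instNumberFieldF; letI := T.instAlgebraF; letI := T.instFieldK
  letI := T.instNumberFieldK; letI := T.instAlgebraK; letI := T.instFieldFbar; letI := T.instAlgebraFbar
  letI := T.instAlgebraKFbar; letI := T.instIsElliptic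
  set w := finBelow T.F T.K u with hwdef
  haveI : w.asIdeal.IsMaximal := w.isMaximal
  have heuw : Ideal.ramificationIdx' w.asIdeal u.asIdeal = u.asIdeal.ramificationIdx (𝓞 T.F) :=
    Ideal.ramificationIdx'_eq_ramificationIdx w.asIdeal u.asIdeal w.ne_bot
  rw [ThetaData.absRamificationIdx_eq_ramIdx_mul (F := T.F) u, show u.under (𝓞 T.F) = w from rfl, ramIdx_eq, heuw,
    T.ramificationIdx_F_K_eq_prime u hu hbad]

end ThetaVolumeDatumAt

end Cor22

end Literature.IUT.LogVolume

end
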